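import Literature.MathematicalPhysics.QuantumFieldTheory.Balaban1983to89.B16Ineq17NearFlatOneSidedSeminorm
import Literature.MathematicalPhysics.QuantumFieldTheory.Balaban1983to89.Node00.WilsonActionFirstVariationNearFlat

/-!
# `Balaban1983to89.B16Ineq17NearFlatWilsonLetters` — [Balaban1989LargeFieldII] (1.7) pp. 357–358 at a near-flat background: THE NODE 00 READING OF THE
# ACTION-SIDE LETTERS of the near-flat one-sided skeleton (`B16Ineq17NearFlatOneSided` ∕ `…Seminorm`) at `a := wilsonAction4 ∘ expChart U₀` on the bond-field
# Pi type `PBond P j → 𝔰𝔲(N)`, sizes by ANY seminorm `p` dominating the `ℓ²(bonds)` operator-norm sum (word (ii) of the N12 lane owner): (δ₁) = `32(d−1)δ`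
# from dag-n12-w2 g2's letter (b), (β) = `16(d−1)` from its boundedness letter + polarisation + Schwarz symmetry, the current factor `j = 2(d−1)δ′` (ℓ¹) from
# this seat's first-variation bound — and the skeleton ASSEMBLED at the Wilson action with these letters inhabited, leaving the averaging-chart letters
# (δ₂)(ρ)(M₂), the family's (K), the bond-wise `A₀` gauge and the Federbush `m` displayed

statement-level skeleton of published theorems with citation tags; proofs where landed; nothing here is a claim about
the Yang–Mills mass gap.

T. Bałaban, *Large field renormalization. II*, Commun. Math. Phys. **122** (1989) 355–392 [Balaban1989LargeFieldII], p. 357 («we write U₀ = exp(iA₀) and expand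
in A₀ up to first order … the leading term … background field identically equal to 1»), (1.7) p. 358, (1.12) p. 359; T. Bałaban, Commun. Math. Phys. **99** (1985)
389–434 [Balaban1985BackgroundPropagators], (3.6)–(3.7) p. 391, (3.10) p. 392; T. Bałaban, Commun. Math. Phys. **102** (1985) 277–309 [Balaban1985Variational],
(5) p. 278, (81)–(83) p. 290, (174)–(177) pp. 305–306.

Cell pub-ymgap, HUMAN RULING D-0062 ∕ D-0149, seat `pub-ymgap-dag-n12-w4` g2 (WIDTH SEAT 4 of DAG node N12 = [B15]; key K1⁷ stmt-QuantumFields-20542, helper,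
count-neutral).  CONSUMED BY NAME, nothing restated: dag-n12-w2 g2's `Node00.abs_deriv_deriv_wilsonAction4_expChart_sub_flat_le_l2` ∕ `…_le_l2` (p593907, the
`ℓ²(bonds)` letters), dag-n12-w3's `B11Eq177CriticalFamilyDerivative.{contDiff_wilsonAction4_expChart, hasFDerivAt_fderiv_wilsonAction4_expChart,
deriv_deriv_wilsonAction4_expChart_smul_eq, hessian_value_criticalFamily}` (p584027 ∕ p588036), this seat's `Node00.abs_deriv_wilsonAction4_expChart_zero_le_l1`
(p595183) and `B16Ineq17NearFlatOneSidedSeminorm.{abs_bilin_le_of_symm_of_diag_seminorm, hessian_value_criticalFamily_ge_flatMin_sub_seminorm}`, Mathlib's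
`second_derivative_symmetric_of_eventually`.

THE SIZES.  `p` is ANY seminorm on the Pi type with `Σ_b ‖X_b‖²_op ≤ p(X)²` (`hp`) — the `ℓ²` seminorm of the Hilbert–Schmidt entries (dag-n12-w2 g2's
op ≤ HS bridge (A1)), or of the operator-norm entries; `p₁` any seminorm with `Σ_b ‖X_b‖_op ≤ p₁(X)` (`hp₁`, for the current).  No volume factor enters.

WHAT THIS FILE PROVES (THEOREMS ONLY — no `def`, no `sorry`; axioms standard).
§1 `letter_delta1_wilson` (★ (δ₁): `D²(A∘expChart 1)(0)(w,w) − 32(d−1)δ·p(w)² ≤ D²(A∘expChart U₀)(0)(w,w)` for a bond-wise `δ`-near-flat `U₀`),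
   `flatSecondVariation_symm` (Schwarz), `abs_flatSecondVariation_diag_le` (`|D²(A∘expChart 1)(0)(w,w)| ≤ 8(d−1)·p(w)²`), ★ `letter_beta_wilson`
   ((β): `|D²(A∘expChart 1)(0)(u,v)| ≤ 16(d−1)·p(u)·p(v)`).
§2 `fderiv_apply_eq_deriv_smul` (bookkeeping), `fderiv_wilsonAction4_expChart_apply_eq_deriv` (the first derivative along the chart applied to `X` is the ray derivative), ★ `letter_j_wilson` (the current
   factor: `|D(A∘expChart U₀)(0)X| ≤ 2(d−1)δ′·p₁(X)` for a plaquette-wise `δ′`-near-flat `U₀`, `δ′ ≥ 0`).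
§3 ★★ `hessian_wilsonAction4_criticalExpChartFamily_ge_flatMin_sub` — THE SKELETON AT THE WILSON ACTION: along any `C²` family `g ↦ X g` of chart points through
   `0` at a bond-wise `δ`-near-flat background `U₀` with the Lagrange form `D(A∘expChart U₀)(0) = λ₀ ∘ DΨ(0)` for a `C²` constraint chart `Ψ` and an affine
   datum, for every `m` dominated by the FLAT second variation on the flat fibre of the datum velocity:
   `m − (32(d−1)δ + μ + 16(d−1)ρδ₂(2 + ρδ₂))·p(X′h)² ≤ D²(g ↦ A(U₀·exp(X g)))(g₀)[h,h]` — (δ₁)(β) INHABITED here; (μ)(δ₂)(ρ)(K) and `m` displayed.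

HONEST SCOPE.  Junction bookkeeping over landed kernel theorems; the bond-wise nearness `‖U₀ b − 1‖ ≤ δ` is a HYPOTHESIS (its producer at the record: the
small-field axial gauge of the background, dag-n13-w2's `…N12SmallFieldAxialGaugeOfBackground`, p595951); the averaging chart `Ψ` and the family `X` are abstract;
nothing of Bałaban's asserted; count-neutral; N12 NOT discharged; K1⁷ NOT closed; one finite 𝕋⁴ programme at fixed `ε`; R4 closes the conditional finite-𝕋⁴ rung
`BalabanLadder.UV` only — the Yang–Mills mass gap (Clay) is NOT proved by any of this; nothing continuum ∕ ℝ⁴ ∕ OS.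
-/

noncomputable section

open Filter Topology Set
open scoped Topology

namespace Literature.MathematicalPhysics.QuantumFieldTheory.Balaban1983to89.B16Ineq17NearFlatWilsonLetters

open T4Continuum B15DeterminingSets
open T4AdjointCovarianceUnitary (lieSU)
open Node00
open scoped Matrix.Norms.L2Operator
open B11Eq177CriticalFamilyDerivative (contDiff_wilsonAction4_expChart hasFDerivAt_fderiv_wilsonAction4_expChart
  deriv_deriv_wilsonAction4_expChart_smul_eq hessian_value_criticalFamily)
open B16Ineq17NearFlatOneSidedSeminorm (abs_bilin_le_of_symm_of_diag_seminorm hessian_value_criticalFamily_ge_flatMin_sub_seminorm)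

variable {P : Params} {j : ℕ} {N : ℕ} [NeZero N]

/-! ## §1  The second-variation letters (δ₁) and (β) at the Wilson action, seminorm sizes -/

section SecondVariation

/-- ★ **LETTER (δ₁) AT THE WILSON ACTION**: for a background with `‖U₀ b − 1‖ ≤ δ` on every bond and any seminorm `p` on the bond-field Pi type dominating the
`ℓ²(bonds)` operator-norm sum, the Hessian of `A∘expChart U₀` at `0` dominates the FLAT Hessian minus `32(d−1)δ·p(w)²` on the diagonal — dag-n12-w2 g2's letter (b)
`…_sub_flat_le_l2` read through dag-n12-w3's ray identity. [cite: Balaban1989LargeFieldII, p.357, (1.7) p.358; Balaban1985BackgroundPropagators, (3.10) p.392] -/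
theorem letter_delta1_wilson (U₀ : GaugeField P j (SU N)) {δ : ℝ} (hU : ∀ b : PBond P j, ‖((U₀ b : SU N) : Matrix (Fin N) (Fin N) ℂ) - 1‖ ≤ δ)
    (p : Seminorm ℝ (PBond P j → lieSU (Fin N))) (hp : ∀ X : PBond P j → lieSU (Fin N), ∑ b, ‖(X b : Matrix (Fin N) (Fin N) ℂ)‖ ^ 2 ≤ p X ^ 2)
    (w : PBond P j → lieSU (Fin N)) :
    fderiv ℝ (fun Y => fderiv ℝ (fun Y : PBond P j → lieSU (Fin N) => wilsonAction4 (expChart (1 : GaugeField P j (SU N)) Y)) Y) 0 w w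
        - 32 * ((P.d : ℝ) - 1) * δ * p w ^ 2
      ≤ fderiv ℝ (fun Y => fderiv ℝ (fun Y : PBond P j → lieSU (Fin N) => wilsonAction4 (expChart U₀ Y)) Y) 0 w w := by
  obtain ⟨b₀⟩ : Nonempty (PBond P j) := ⟨⟨default, ⟨0, P.hd⟩⟩⟩
  have hδ0 : 0 ≤ δ := (norm_nonneg _).trans (hU b₀)
  have hd : 0 ≤ (P.d : ℝ) - 1 := by
    have := P.hd
    have h1 : (1 : ℝ) ≤ P.d := by exact_mod_cast this
    linarith
  have h := abs_deriv_deriv_wilsonAction4_expChart_sub_flat_le_l2 U₀ w hU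
  rw [deriv_deriv_wilsonAction4_expChart_smul_eq U₀ w, deriv_deriv_wilsonAction4_expChart_smul_eq 1 w] at h
  have h2 : 32 * ((P.d : ℝ) - 1) * δ * ∑ b, ‖(w b : Matrix (Fin N) (Fin N) ℂ)‖ ^ 2 ≤ 32 * ((P.d : ℝ) - 1) * δ * p w ^ 2 :=
    mul_le_mul_of_nonneg_left (hp w) (by positivity)
  have h3 := (abs_le.mp h).1
  linarith

/-- **THE FLAT HESSIAN IS SYMMETRIC** (Schwarz, for the `C^ω` function `A∘expChart 1`). [cite: Balaban1985BackgroundPropagators, (3.10) p.392 (bookkeeping)] -/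
theorem flatSecondVariation_symm (u v : PBond P j → lieSU (Fin N)) :
    fderiv ℝ (fun Y => fderiv ℝ (fun Y : PBond P j → lieSU (Fin N) => wilsonAction4 (expChart (1 : GaugeField P j (SU N)) Y)) Y) 0 u v
      = fderiv ℝ (fun Y => fderiv ℝ (fun Y : PBond P j → lieSU (Fin N) => wilsonAction4 (expChart (1 : GaugeField P j (SU N)) Y)) Y) 0 v u := by
  have hd : ∀ Y : PBond P j → lieSU (Fin N),
      HasFDerivAt (fun Y : PBond P j → lieSU (Fin N) => wilsonAction4 (expChart (1 : GaugeField P j (SU N)) Y))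
        (fderiv ℝ (fun Y : PBond P j → lieSU (Fin N) => wilsonAction4 (expChart (1 : GaugeField P j (SU N)) Y)) Y) Y :=
    fun Y => ((contDiff_wilsonAction4_expChart (1 : GaugeField P j (SU N))).differentiable (by simp)).differentiableAt.hasFDerivAt
  exact second_derivative_symmetric_of_eventually (Filter.Eventually.of_forall hd)
    (hasFDerivAt_fderiv_wilsonAction4_expChart (1 : GaugeField P j (SU N)) 0) u v

/-- **THE FLAT HESSIAN IS BOUNDED ON THE DIAGONAL**: `|D²(A∘expChart 1)(0)(w,w)| ≤ 8(d−1)·p(w)²` — dag-n12-w2 g2's `…_le_l2` at `U = 1` through the ray identity.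
[cite: Balaban1985BackgroundPropagators, (3.10) p.392 («a bounded … operator»); Balaban1989LargeFieldII, (1.7) p.358] -/
theorem abs_flatSecondVariation_diag_le (p : Seminorm ℝ (PBond P j → lieSU (Fin N)))
    (hp : ∀ X : PBond P j → lieSU (Fin N), ∑ b, ‖(X b : Matrix (Fin N) (Fin N) ℂ)‖ ^ 2 ≤ p X ^ 2) (w : PBond P j → lieSU (Fin N)) :
    |fderiv ℝ (fun Y => fderiv ℝ (fun Y : PBond P j → lieSU (Fin N) => wilsonAction4 (expChart (1 : GaugeField P j (SU N)) Y)) Y) 0 w w|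
      ≤ 8 * ((P.d : ℝ) - 1) * p w ^ 2 := by
  have hd : 0 ≤ (P.d : ℝ) - 1 := by
    have := P.hd
    have h1 : (1 : ℝ) ≤ P.d := by exact_mod_cast this
    linarith
  have h := abs_deriv_deriv_wilsonAction4_expChart_le_l2 (1 : GaugeField P j (SU N)) w
  rw [deriv_deriv_wilsonAction4_expChart_smul_eq 1 w] at h
  exact h.trans (mul_le_mul_of_nonneg_left (hp w) (by positivity))

/-- ★ **LETTER (β) AT THE WILSON ACTION**: `|D²(A∘expChart 1)(0)(u,v)| ≤ 16(d−1)·p(u)·p(v)` — the diagonal bound polarised (symmetric form, seminorm sizes).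
[cite: Balaban1985BackgroundPropagators, (3.10) p.392; Balaban1989LargeFieldII, (1.7) p.358] -/
theorem letter_beta_wilson (p : Seminorm ℝ (PBond P j → lieSU (Fin N)))
    (hp : ∀ X : PBond P j → lieSU (Fin N), ∑ b, ‖(X b : Matrix (Fin N) (Fin N) ℂ)‖ ^ 2 ≤ p X ^ 2) (u v : PBond P j → lieSU (Fin N)) :
    |fderiv ℝ (fun Y => fderiv ℝ (fun Y : PBond P j → lieSU (Fin N) => wilsonAction4 (expChart (1 : GaugeField P j (SU N)) Y)) Y) 0 u v|
      ≤ 16 * ((P.d : ℝ) - 1) * p u * p v := by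
  have hd : 0 ≤ (P.d : ℝ) - 1 := by
    have := P.hd
    have h1 : (1 : ℝ) ≤ P.d := by exact_mod_cast this
    linarith
  have h := abs_bilin_le_of_symm_of_diag_seminorm p
    (fderiv ℝ (fun Y => fderiv ℝ (fun Y : PBond P j → lieSU (Fin N) => wilsonAction4 (expChart (1 : GaugeField P j (SU N)) Y)) Y) 0)
    flatSecondVariation_symm (β' := 8 * ((P.d : ℝ) - 1)) (by positivity) (abs_flatSecondVariation_diag_le p hp) u v
  calc _ ≤ 2 * (8 * ((P.d : ℝ) - 1)) * p u * p v := h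
    _ = 16 * ((P.d : ℝ) - 1) * p u * p v := by ring

end SecondVariation

/-! ## §2  The current factor `j` at the Wilson action, seminorm sizes -/

section Current

omit [NeZero N] in
/-- Abstract bookkeeping: the Fréchet derivative at `0` applied to `X` is the derivative along the ray `s ↦ sX`.
[cite: Balaban1985BackgroundPropagators, (3.7) p.391 (bookkeeping)] -/
theorem fderiv_apply_eq_deriv_smul {E : Type*} [NormedAddCommGroup E] [NormedSpace ℝ E] {a : E → ℝ} (ha : DifferentiableAt ℝ a 0) (X : E) :
    fderiv ℝ a 0 X = deriv (fun s : ℝ => a (s • X)) 0 := by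
  have hline : HasDerivAt (fun s : ℝ => s • X) X 0 := by simpa using (hasDerivAt_id (0 : ℝ)).smul_const X
  have h0 : (fun s : ℝ => s • X) 0 = 0 := by simp
  have ha' : HasFDerivAt a (fderiv ℝ a 0) ((fun s : ℝ => s • X) 0) := by
    rw [h0]
    exact ha.hasFDerivAt
  exact (ha'.comp_hasDerivAt (0 : ℝ) hline).deriv.symm

/-- The first derivative of `A∘expChart U₀` at `0` applied to `X` is the ray derivative `d∕ds A(U₀·e^{sX})∣₀`.
[cite: Balaban1985BackgroundPropagators, (3.7) p.391 (bookkeeping)] -/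
theorem fderiv_wilsonAction4_expChart_apply_eq_deriv (U₀ : GaugeField P j (SU N)) (X : PBond P j → lieSU (Fin N)) :
    fderiv ℝ (fun Y : PBond P j → lieSU (Fin N) => wilsonAction4 (expChart U₀ Y)) 0 X
      = deriv (fun s : ℝ => wilsonAction4 (expChart U₀ (s • X))) 0 :=
  fderiv_apply_eq_deriv_smul ((contDiff_wilsonAction4_expChart U₀).differentiable (by simp)).differentiableAt X

/-- ★ **THE CURRENT FACTOR `j` AT THE WILSON ACTION**: for a background with `‖U₀(∂p) − 1‖ ≤ δ′` on every plaquette and any seminorm `p₁` dominating the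
`ℓ¹(bonds)` operator-norm sum, `|D(A∘expChart U₀)(0)X| ≤ 2(d−1)δ′·p₁(X)` — this seat's `Node00.abs_deriv_wilsonAction4_expChart_zero_le_l1` read as the letter `hj`
of `abs_multiplier_apply_le_seminorm`. [cite: Balaban1989LargeFieldII, (1.12) p.359, p.357; Balaban1985Variational, (2) p.278] -/
theorem letter_j_wilson (U₀ : GaugeField P j (SU N)) {δ' : ℝ} (hδ' : 0 ≤ δ')
    (hcurv : ∀ q : Plaq P j, ‖((GaugeField.plaqHol U₀ q : SU N) : Matrix (Fin N) (Fin N) ℂ) - 1‖ ≤ δ')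
    (p₁ : Seminorm ℝ (PBond P j → lieSU (Fin N))) (hp₁ : ∀ X : PBond P j → lieSU (Fin N), ∑ b, ‖(X b : Matrix (Fin N) (Fin N) ℂ)‖ ≤ p₁ X)
    (X : PBond P j → lieSU (Fin N)) :
    |fderiv ℝ (fun Y : PBond P j → lieSU (Fin N) => wilsonAction4 (expChart U₀ Y)) 0 X| ≤ 2 * ((P.d : ℝ) - 1) * δ' * p₁ X := by
  have hd : 0 ≤ (P.d : ℝ) - 1 := by
    have := P.hd
    have h1 : (1 : ℝ) ≤ P.d := by exact_mod_cast this
    linarith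
  rw [fderiv_wilsonAction4_expChart_apply_eq_deriv]
  exact (abs_deriv_wilsonAction4_expChart_zero_le_l1 U₀ X hcurv).trans (mul_le_mul_of_nonneg_left (hp₁ X) (by positivity))

end Current

/-! ## §3  The skeleton assembled at the Wilson action -/

section Assembly

/-- ★★ **THE NEAR-FLAT ONE-SIDED (1.7) SKELETON AT THE WILSON ACTION, ACTION-SIDE LETTERS INHABITED.**  Background `U₀` with `‖U₀ b − 1‖ ≤ δ` on every bond;
`a := A∘expChart U₀` on the bond-field Pi type; a `C²` constraint chart `Ψ` (values in a finite-dimensional `V`) with the Lagrange form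
`Da(0) = λ₀ ∘ DΨ(0)`; ANY `C²` family `g ↦ X g` of chart points through `0` with an affine datum (`λ₀(D²(Ψ∘X)(g₀)[h,h]) = 0`); a seminorm `p` dominating the
`ℓ²(bonds)` operator-norm sum; the flat linearised constraint `L♭` with a right inverse `R♭` (`p(R♭v) ≤ ρ·q(v)`), the averaging letters (δ₂) `q(DΨ(0)w − L♭w) ≤ δ₂·p(w)`
and (μ) `λ₀(Ψ₂(w,w)) ≤ μ·p(w)²` at `w := X′h`.  THEN for every `m` dominated by the FLAT second variation `D²(A∘expChart 1)(0)` on the flat fibre of `DΨ(0)w`: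
`m − (32(d−1)δ + μ + 16(d−1)ρδ₂(2 + ρδ₂))·p(X′h)² ≤ D²(g ↦ A(U₀·exp(X g)))(g₀)[h,h]` — (δ₁) and (β) inhabited by dag-n12-w2 g2's letters, the rest displayed.
[cite: Balaban1989LargeFieldII, (1.7) pp.357–358, (1.12) p.359; Balaban1985BackgroundPropagators, (3.10) p.392; Balaban1985Variational, (81)–(83) p.290, (174)–(177) pp.305–306] -/
theorem hessian_wilsonAction4_criticalExpChartFamily_ge_flatMin_sub
    {V G : Type*} [NormedAddCommGroup V] [NormedSpace ℝ V] [NormedAddCommGroup G] [NormedSpace ℝ G]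
    (U₀ : GaugeField P j (SU N)) {δ : ℝ} (hU : ∀ b : PBond P j, ‖((U₀ b : SU N) : Matrix (Fin N) (Fin N) ℂ) - 1‖ ≤ δ)
    {Ψ : (PBond P j → lieSU (Fin N)) → V} {X : G → PBond P j → lieSU (Fin N)} {g₀ : G}
    (hX₀ : X g₀ = 0) {X' : G →L[ℝ] PBond P j → lieSU (Fin N)} (hX : HasFDerivAt X X' g₀)
    {X₂ : G →L[ℝ] G →L[ℝ] PBond P j → lieSU (Fin N)} (hX₂ : HasFDerivAt (fun g => fderiv ℝ X g) X₂ g₀)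
    (hXd : ∀ᶠ g in 𝓝 g₀, DifferentiableAt ℝ X g)
    {Ψ₂ : (PBond P j → lieSU (Fin N)) →L[ℝ] (PBond P j → lieSU (Fin N)) →L[ℝ] V} (hΨ₂ : HasFDerivAt (fun Y => fderiv ℝ Ψ Y) Ψ₂ 0)
    (hΨd : ∀ᶠ Y in 𝓝 (0 : PBond P j → lieSU (Fin N)), DifferentiableAt ℝ Ψ Y)
    {lam : V →L[ℝ] ℝ} (hlam : fderiv ℝ (fun Y : PBond P j → lieSU (Fin N) => wilsonAction4 (expChart U₀ Y)) 0 = lam.comp (fderiv ℝ Ψ 0)) (h : G)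
    (haff : lam (fderiv ℝ (fun g => fderiv ℝ (fun g => Ψ (X g)) g) g₀ h h) = 0)
    (p : Seminorm ℝ (PBond P j → lieSU (Fin N))) (hp : ∀ Y : PBond P j → lieSU (Fin N), ∑ b, ‖(Y b : Matrix (Fin N) (Fin N) ℂ)‖ ^ 2 ≤ p Y ^ 2)
    (q : V → ℝ) (Lf : (PBond P j → lieSU (Fin N)) →L[ℝ] V) {Rf : V → PBond P j → lieSU (Fin N)} {μ ρ δ₂ : ℝ} (hρ0 : 0 ≤ ρ)
    (hRf : ∀ v, Lf (Rf v) = v) (hρ : ∀ v, p (Rf v) ≤ ρ * q v)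
    (hδ₂ : q (fderiv ℝ Ψ 0 (X' h) - Lf (X' h)) ≤ δ₂ * p (X' h))
    (hμ : lam (Ψ₂ (X' h) (X' h)) ≤ μ * p (X' h) ^ 2)
    {m : ℝ} (hm : ∀ w', Lf w' = fderiv ℝ Ψ 0 (X' h) →
      m ≤ fderiv ℝ (fun Y => fderiv ℝ (fun Y : PBond P j → lieSU (Fin N) => wilsonAction4 (expChart (1 : GaugeField P j (SU N)) Y)) Y) 0 w' w') :
    m - (32 * ((P.d : ℝ) - 1) * δ + μ + 16 * ((P.d : ℝ) - 1) * (ρ * δ₂) * (2 + ρ * δ₂)) * p (X' h) ^ 2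
      ≤ fderiv ℝ (fun g => fderiv ℝ (fun g => wilsonAction4 (expChart U₀ (X g))) g) g₀ h h := by
  have hd : 0 ≤ (P.d : ℝ) - 1 := by
    have := P.hd
    have h1 : (1 : ℝ) ≤ P.d := by exact_mod_cast this
    linarith
  exact hessian_value_criticalFamily_ge_flatMin_sub_seminorm hX₀ hX hX₂ hXd (hasFDerivAt_fderiv_wilsonAction4_expChart U₀ 0)
    (Filter.Eventually.of_forall fun Y => ((contDiff_wilsonAction4_expChart U₀).differentiable (by simp)).differentiableAt)
    hΨ₂ hΨd hlam h haff p q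
    (fderiv ℝ (fun Y => fderiv ℝ (fun Y : PBond P j → lieSU (Fin N) => wilsonAction4 (expChart (1 : GaugeField P j (SU N)) Y)) Y) 0)
    Lf (β := 16 * ((P.d : ℝ) - 1)) (by positivity) hρ0 (letter_beta_wilson p hp) hRf hρ hδ₂ (letter_delta1_wilson U₀ hU p hp (X' h)) hμ hm

end Assembly

end Literature.MathematicalPhysics.QuantumFieldTheory.Balaban1983to89.B16Ineq17NearFlatWilsonLetters

end
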